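import Summits.CriticalPhenomena.PercolationContinuityZ3.Theorems.PercNearOneGluingNoHeavyLowerTailSahiCTCLevelDuality
import Summits.CriticalPhenomena.PercolationContinuityZ3.Theorems.PercNearOneGluingNoHeavyLowerTailSahiCTCHarrisUp
import Summits.CriticalPhenomena.PercolationContinuityZ3.Theorems.PercNearOneGluingNoHeavyLowerTailSahiCTCRPrime
import Summits.CriticalPhenomena.PercolationContinuityZ3.Theorems.PercNearOneGluingNoHeavyLowerTailSahiAllButCPolya
import HarnessLib

/-!
# `NoHeavyLowerTail` (crux stmt-CriticalPhenomena-4575), P3 lane: THE GENERAL-LEVEL SPLIT `M_t = Π·L_t + e_t·R_t` AND THE STRUCTURE OF `R_t`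
# — `R_t = Θ_{t−1}·H + Π·N_t` (Harris form + small-world form); the slot "at least `t` of `k` open" from `(L_t)`, `(R_t)` and the Pólya row

Support file (seat `prim-l12-p3`, gen 28; `--supports stmt-CriticalPhenomena-4575`).  Memo
`run/shared/lean/prim/prim-l12/FROM-prim-l12-p3-g28-TRANSFER-PRINCIPLE.md` §1–§3 (and memos g24 §5.5, g27 §0 for `L_t`, `R_t`).

For an open threshold `t`, up-sets `𝒳, 𝒵 ⊆ 2^α`, `Θ_{t−1} = GF(sets of size < t)`, `Π = GF(2^α)`, `e_t = GF(t-sets)`: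
* `ladderT t 𝒳 𝒵 = e_t·(Π·Y_{≥t} − X_{≥t}·Z_{≥t}) − Θ_{t−1}·e_{≥t}·Y_{=t}`   (the LADDER form `L_t`, all-live parts; memo g24 §5.5),
* `Rt t 𝒳 𝒵      = Θ_{t−1}·(Π·Y_{≥t} − X·Z) + Π·X_{<t}·Z_{<t}`              (the R form `R_t`; `t = 2` is `…SahiCTCRPrime`),
* `Nt t 𝒳 𝒵      = X_{<t}·Z_{<t} − Θ_{t−1}·Y_{<t}`                          (the SMALL-WORLD form; value level `−θ²·Cov(𝒳,𝒵 | N<t)`).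
THIS FILE proves the bookkeeping that turns the level-`t` programme into two named polynomial targets:
* `Mop_eq_ladderT_add_Rt` : **`M_t = Π·L_t + e_t·R_t`** (`M_t = Mop t` of `…SahiCTCLevelDuality`), hence `coeff_Mop_nonneg_of_ladderT_of_Rt`;
* `Rt_eq_harris_add_Nt`  : **`R_t = Θ_{t−1}·(Π·Y − X·Z) + Π·N_t`**, hence `coeff_Rt_nonneg_of_Nt` (`R_t ∈ ℕ[s]` as soon as `N_t ∈ ℕ[s]`, by the Harris
  block `…SahiCTCHarrisUp`) and `coeff_Rt_nonneg_of_below_inter_eq_empty` (**`R_t ∈ ℕ[s]` for every pair without common members of size `< t`**,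
  every `t` — the "no common small sets" regime of memo g27 §5(a));
* `Rt_two_eq`, `coeff_Rt_two_nonneg` : consistency with `…SahiCTCRPrime` (`R_2 ∈ ℕ[s]` for every pair);
* on the pattern cube: `ev_Ngen_cx_nonneg_of_ladderT_of_Rt` and **`sahiE_three_nonneg_threshold_of_ladderT_of_Rt`**: Kahn C5 / Sahi C₃ for the slot
  "at least `t` of `k` open" follows from `(L_t)`, `(R_t)` (coefficientwise, all up-set pairs on `Fin k`) and the Pólya row (a) of `…SahiAllButCPolya`.
Nothing is asserted about the crux; `(L_t)`, `(R_t)` for `t ≥ 3` and the Pólya row are NOT proved here.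
-/

noncomputable section

open scoped Classical

namespace Summit.CriticalPhenomena.PercolationContinuityZ3.Theorems

namespace SahiCTCForms

open Finset MvPolynomial SahiCTCGenFun

variable {α : Type*} [DecidableEq α] [Fintype α]

/-! ### The three level-`t` forms -/

/-- **The ladder form `L_t = e_t·(Π·Y_{≥t} − X_{≥t}·Z_{≥t}) − Θ_{t−1}·e_{≥t}·Y_{=t}`** (all-live parts of the pair). [this work] -/
def ladderT (t : ℕ) (F G : Finset (Finset α)) : MvPolynomial α ℤ :=
  ee t * (PiP * gf (atLeast t (F ∩ G)) - gf (atLeast t F) * gf (atLeast t G))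
    - gf (bySize (· < t)) * gf (bySize (t ≤ ·)) * gf (exact t (F ∩ G))

/-- **The R form `R_t = Θ_{t−1}·(Π·Y_{≥t} − X·Z) + Π·X_{<t}·Z_{<t}`** (loops and small sets). [this work] -/
def Rt (t : ℕ) (F G : Finset (Finset α)) : MvPolynomial α ℤ :=
  gf (bySize (· < t)) * (PiP * gf (atLeast t (F ∩ G)) - gf F * gf G) + PiP * (gf (below t F) * gf (below t G))

/-- **The small-world form `N_t = X_{<t}·Z_{<t} − Θ_{t−1}·Y_{<t}`** (at value level `−P(N<t)²·Cov(𝒳,𝒵 | N<t)`). [this work] -/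
def Nt (t : ℕ) (F G : Finset (Finset α)) : MvPolynomial α ℤ :=
  gf (below t F) * gf (below t G) - gf (bySize (· < t)) * gf (below t (F ∩ G))

/-! ### Size splits -/

omit [Fintype α] in
/-- A family is the disjoint union of its members of size `≥ t` and `< t`: `GF(F) = GF(F_{≥t}) + GF(F_{<t})`. [this work] -/
theorem gf_eq_atLeast_add_below (t : ℕ) (F : Finset (Finset α)) : gf F = gf (atLeast t F) + gf (below t F) := by
  rw [← gf_union]
  · congr 1; ext S
    simp only [atLeast, below, mem_union, mem_filter]
    constructor
    · intro h; by_cases ht : t ≤ #S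
      · exact Or.inl ⟨h, ht⟩
      · exact Or.inr ⟨h, by omega⟩
    · rintro (⟨h, _⟩ | ⟨h, _⟩) <;> exact h
  · rw [disjoint_left]; intro S h1 h2
    simp only [atLeast, below, mem_filter] at h1 h2; omega

/-- `Π = Θ_{t−1} + e_{≥t}`: all sets split by size `< t` / `≥ t`. [this work] -/
theorem PiP_eq_bySize_lt_add_ge (t : ℕ) : (PiP : MvPolynomial α ℤ) = gf (bySize (· < t)) + gf (bySize (t ≤ ·)) := by
  unfold PiP bySize
  rw [← gf_union]
  · congr 1; ext S
    simp only [mem_union, mem_filter, mem_powerset, subset_univ, true_and, true_iff]; omega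
  · rw [disjoint_left]; intro S h1 h2
    simp only [mem_filter] at h1 h2; omega

omit [Fintype α] in
/-- The members of size `≥ t` / `< t` of an intersection. [this work] -/
theorem gf_inter_eq_atLeast_add_below (t : ℕ) (F G : Finset (Finset α)) :
    gf (F ∩ G) = gf (atLeast t (F ∩ G)) + gf (below t (F ∩ G)) := gf_eq_atLeast_add_below t (F ∩ G)

/-! ### `M_t = Π·L_t + e_t·R_t` -/

/-- **The split of the level-`t` master form**: `M_t(𝒳,𝒵) = Π·L_t(𝒳,𝒵) + e_t·R_t(𝒳,𝒵)`. [this work] -/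
theorem Mop_eq_ladderT_add_Rt (t : ℕ) (F G : Finset (Finset α)) : Mop t F G = PiP * ladderT t F G + ee t * Rt t F G := by
  rw [Mop_eq]
  unfold ladderT Rt
  rw [gf_eq_atLeast_add_below t F, gf_eq_atLeast_add_below t G]
  rw [PiP_eq_bySize_lt_add_ge (α := α) t]
  ring

/-- **`M_t ∈ ℕ[s]` as soon as `L_t ∈ ℕ[s]` and `R_t ∈ ℕ[s]`** (coefficientwise). [this work] -/
theorem coeff_Mop_nonneg_of_ladderT_of_Rt {t : ℕ} {F G : Finset (Finset α)} (hL : ∀ m, 0 ≤ (ladderT t F G).coeff m)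
    (hR : ∀ m, 0 ≤ (Rt t F G).coeff m) (n : α →₀ ℕ) : 0 ≤ (Mop t F G).coeff n := by
  rw [Mop_eq_ladderT_add_Rt, coeff_add]
  refine add_nonneg ?_ ?_
  · unfold PiP; exact coeff_mul_nonneg (coeff_gf_nonneg _) hL n
  · unfold ee; exact coeff_mul_nonneg (coeff_gf_nonneg _) hR n

/-! ### `R_t = Θ_{t−1}·H + Π·N_t` -/

/-- **Structure of the R form**: `R_t = Θ_{t−1}·(Π·GF(𝒳∩𝒵) − GF(𝒳)·GF(𝒵)) + Π·N_t` — the Harris form weighted by the small world plus `Π` times the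
small-world form. [this work] -/
theorem Rt_eq_harris_add_Nt (t : ℕ) (F G : Finset (Finset α)) :
    Rt t F G = gf (bySize (· < t)) * (PiP * gf (F ∩ G) - gf F * gf G) + PiP * Nt t F G := by
  unfold Rt Nt
  rw [gf_inter_eq_atLeast_add_below t F G]
  ring

/-- **`R_t ∈ ℕ[s]` whenever the small-world form `N_t` has nonnegative coefficients** (up-sets `𝒳, 𝒵`; the Harris block pays the rest). [this work] -/
theorem coeff_Rt_nonneg_of_Nt {t : ℕ} {F G : Finset (Finset α)} (hF : IsUpperSet (F : Set (Finset α)))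
    (hG : IsUpperSet (G : Set (Finset α))) (hN : ∀ m, 0 ≤ (Nt t F G).coeff m) (n : α →₀ ℕ) : 0 ≤ (Rt t F G).coeff n := by
  rw [Rt_eq_harris_add_Nt, coeff_add]
  refine add_nonneg ?_ ?_
  · unfold bySize; exact coeff_mul_nonneg (coeff_gf_nonneg _) (coeff_harris_up_sub_nonneg hF hG) n
  · unfold PiP; exact coeff_mul_nonneg (coeff_gf_nonneg _) hN n

/-- **`R_t ∈ ℕ[s]` for every pair of up-sets WITHOUT COMMON MEMBERS OF SIZE `< t`** (every `t`; memo g27 §5(a), here from the structure identity: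
`N_t = X_{<t}·Z_{<t} ≥ 0`). [this work] -/
theorem coeff_Rt_nonneg_of_below_inter_eq_empty {t : ℕ} {F G : Finset (Finset α)} (hF : IsUpperSet (F : Set (Finset α)))
    (hG : IsUpperSet (G : Set (Finset α))) (h0 : below t (F ∩ G) = ∅) (n : α →₀ ℕ) : 0 ≤ (Rt t F G).coeff n := by
  refine coeff_Rt_nonneg_of_Nt hF hG (fun m => ?_) n
  unfold Nt
  rw [h0, gf_empty, mul_zero, sub_zero]
  exact coeff_mul_nonneg (coeff_gf_nonneg _) (coeff_gf_nonneg _) m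

/-- In particular **`R_t ∈ ℕ[s]` when one of the two up-sets has no member of size `< t`** (`t`-live). [this work] -/
theorem coeff_Rt_nonneg_of_below_eq_empty {t : ℕ} {F G : Finset (Finset α)} (hF : IsUpperSet (F : Set (Finset α)))
    (hG : IsUpperSet (G : Set (Finset α))) (h0 : below t F = ∅) (n : α →₀ ℕ) : 0 ≤ (Rt t F G).coeff n := by
  refine coeff_Rt_nonneg_of_below_inter_eq_empty hF hG ?_ n
  refine eq_empty_iff_forall_notMem.2 fun S hS => ?_
  have hS' : S ∈ below t F := by
    simp only [below, mem_filter, mem_inter] at hS ⊢; exact ⟨hS.1.1, hS.2⟩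
  rw [h0] at hS'; exact notMem_empty S hS'

/-! ### Consistency with `…SahiCTCRPrime` (`t = 2`) -/

/-- `R_2` is the form `R'` of `…SahiCTCRPrime`. [this work] -/
theorem Rt_two_eq (F G : Finset (Finset α)) :
    Rt 2 F G = Th1 * (PiP * gf ((F ∩ G).filter fun S => 2 ≤ #S) - gf F * gf G)
      + PiP * gf (F.filter fun S => #S ≤ 1) * gf (G.filter fun S => #S ≤ 1) := by
  have h1 : (bySize (· < 2) : Finset (Finset α)) = bySize (· ≤ 1) := by
    unfold bySize; ext S; simp only [mem_filter]
    constructor <;> rintro ⟨hS, hc⟩ <;> exact ⟨hS, by omega⟩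
  have h2 : ∀ K : Finset (Finset α), below 2 K = K.filter fun S => #S ≤ 1 := fun K => by
    ext S; simp only [below, mem_filter]
    constructor <;> rintro ⟨hS, hc⟩ <;> exact ⟨hS, by omega⟩
  unfold Rt Th1 atLeast
  rw [h1, h2, h2, mul_assoc]

/-- **`R_2 ∈ ℕ[s]` for every pair of up-sets** (= `…SahiCTCRPrime.coeff_Rprime_nonneg`). [this work] -/
theorem coeff_Rt_two_nonneg {F G : Finset (Finset α)} (hF : IsUpperSet (F : Set (Finset α))) (hG : IsUpperSet (G : Set (Finset α)))
    (n : α →₀ ℕ) : 0 ≤ (Rt 2 F G).coeff n := by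
  rw [Rt_two_eq]; exact coeff_Rprime_nonneg hF hG n

end SahiCTCForms

/-! ### On the pattern cube: the slot "at least `t` of `k` open" from `(L_t)`, `(R_t)` and the Pólya row -/

namespace SahiAllButC

open Finset MvPolynomial
open SahiHittingSlot SahiTransportCert SahiAllButOne SahiAllButTwo SahiCTCForms SahiCTCGenFun
open Literature.Combinatorics.Sahi2008
open Literature.Probability.Percolation (DeterminedBy)
open Literature.Probability.Percolation.DecisionTree (ind)

variable {k : ℕ}

/-- **(TC) row of `ρ_{k−t}` from `(L_t)` and `(R_t)`**: if the ladder form and the R form have nonnegative coefficients for every pair of up-sets of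
`2^{Fin k}`, then `Ñ_{k−t}(K_𝒳,K_𝒵)(r) ≥ 0` at the odds vector of every interior parameter vector, for all increasing `𝒳, 𝒵`. [this work] -/
theorem ev_Ngen_cx_nonneg_of_ladderT_of_Rt {t : ℕ} (ht : t ≤ k) {q : Fin k → unitInterval} (hq : ∀ i, 0 < (q i : ℝ) ∧ (q i : ℝ) < 1)
    (hL : ∀ F G : Finset (Finset (Fin k)), IsUpperSet (F : Set (Finset (Fin k))) → IsUpperSet (G : Set (Finset (Fin k))) →
      ∀ m, 0 ≤ (ladderT t F G).coeff m)
    (hR : ∀ F G : Finset (Finset (Fin k)), IsUpperSet (F : Set (Finset (Fin k))) → IsUpperSet (G : Set (Finset (Fin k))) →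
      ∀ m, 0 ≤ (Rt t F G).coeff m)
    {𝒳 𝒵 : Set (Set (Fin k))} (h𝒳 : IsUpperSet 𝒳) (h𝒵 : IsUpperSet 𝒵) : 0 ≤ ev q (Ngen (k - t) (cx 𝒳) (cx 𝒵)) :=
  ev_Ngen_cx_nonneg_of_Mop ht hq fun n =>
    coeff_Mop_nonneg_of_ladderT_of_Rt (hL _ _ (isUpperSet_openFam h𝒳) (isUpperSet_openFam h𝒵))
      (hR _ _ (isUpperSet_openFam h𝒳) (isUpperSet_openFam h𝒵)) n

/-- **KAHN C5 / SAHI C₃ FOR THE SLOT "AT LEAST `t` OF `k` OPEN" FROM THREE COEFFICIENTWISE STATEMENTS**: the ladder inequality `(L_t)` and the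
R-form inequality `(R_t)` for every pair of up-sets of `2^{Fin k}`, and the Pólya certificate of row (a) (`…SahiAllButCPolya`).  For `t = 2` all three
are theorems of the lane (`…SahiCTCLadderTwo`, `…SahiCTCRPrime`, `…SahiAllButTwoRowA`). [this work] -/
theorem sahiE_three_nonneg_threshold_of_ladderT_of_Rt {ι : Type} [Fintype ι] (p : ι → unitInterval) (e : Fin k ↪ ι) {t : ℕ} (ht : t ≤ k)
    (hp : ∀ i, 0 < (p (e i) : ℝ) ∧ (p (e i) : ℝ) < 1)
    (hPolya : ∀ n, 0 ≤ (PiP * ((PiP + DdC (k - t)) * ee (k - t) - ThC (k - t) * DdC (k - t)) : MvPolynomial (Fin k) ℤ).coeff n)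
    (hL : ∀ F G : Finset (Finset (Fin k)), IsUpperSet (F : Set (Finset (Fin k))) → IsUpperSet (G : Set (Finset (Fin k))) →
      ∀ m, 0 ≤ (ladderT t F G).coeff m)
    (hR : ∀ F G : Finset (Finset (Fin k)), IsUpperSet (F : Set (Finset (Fin k))) → IsUpperSet (G : Set (Finset (Fin k))) →
      ∀ m, 0 ≤ (Rt t F G).coeff m)
    {H : Set (Set ι)} (hH : DeterminedBy H (Set.range e)) (hpat : pat e H = allBut (k - t) k) {U V : Set (Set ι)} (hU : IsUpperSet U)
    (hV : IsUpperSet V) : 0 ≤ sahiE (bernoulliWeight p) 3 ![ind H, ind U, ind V] :=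
  sahiE_three_nonneg_of_allBut_of_polya p e (Nat.sub_le k t) hp hPolya
    (fun _ _ h𝒳 h𝒵 _ _ => ev_Ngen_cx_nonneg_of_ladderT_of_Rt ht hp hL hR h𝒳 h𝒵) hH hpat hU hV

end SahiAllButC

end Summit.CriticalPhenomena.PercolationContinuityZ3.Theorems
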